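import Mathlib
import Summits.Schanuel.Schanuel.Theses.RigidCore
import Summits.Schanuel.Schanuel.Theorems.AclSubsetLogFreeCore.Negative.RealDefinableCalibration

/-!
# Crux `SchanuelOnLogFreeCore` (R), line `sector-split` — calibration C21: log-freeness of the core + (A) ⟹ `ℝ ⊆ ℂ` is not `∅`-definable in `ℂ_exp = (ℂ, +, ·, exp)`

Calibration C21 of line `sector-split` for the crux stmt-Schanuel-0970 `RigidCore.SchanuelOnLogFreeCore`
(R).  We prove `stub_realUndefinable_of_logFree`:

*if the log-free core `C_EA = logFreeCore` is log-free — every `u ∈ C_EA` with `eᵘ` algebraic over `ℚ`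
lies on the kernel line `ℚ·2πi` — and the route's symmetry crux (A) `RigidCore.AclSubsetLogFreeCore`
(`acl^{ℂ_exp}(∅) ⊆ C_EA`) holds, then the set of reals `ℝ ⊆ ℂ` is NOT `∅`-definable in the
exponential field `ℂ_exp = (ℂ, +, ·, exp)`.*

Proof: under (A) + `Def_∅(ℝ)` the (A)-chain's landed
`AclSubsetLogFreeCore.Negative.log_two_mem_logFreeCore_of_real_definable` puts `ln 2 ∈ C_EA`; but
`e^{ln 2} = 2` is algebraic, so log-freeness forces `ln 2 ∈ ℚ·2πi`, and a real number on the kernel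
line is `0 ≠ ln 2` (`RealUndefinable.ofReal_mem_span_two_pi_I_iff`).

The first hypothesis is exactly the conclusion of the lead's stub C20 (`(R) ⟹` the log-free core is
log-free); composed with it this file gives **(A) ∧ (R) ⟹ Koiran's conjecture** in the parameter-free
case (`ℝ` is not `∅`-definable in `ℂ_exp`), an undefinability statement that is open.

## References

* [Koiran2003] P. Koiran, *The theory of Liouville functions*, J. Symbolic Logic 68 (2003) 353–365
  (conjecture: `ℝ` is not definable in `ℂ_exp`).
* [KirbyMacintyreOnshuus2012] J. Kirby, A. Macintyre, A. Onshuus, *The algebraic numbers definable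
  in various exponential fields*, J. Inst. Math. Jussieu 11 (2012) 825–834, arXiv:1101.4224, p. 2
  (definability of `ℝ` in `ℂ_exp` is one of the "two main open questions").
-/

noncomputable section

set_option linter.dupNamespace false

open Summit.Schanuel.Schanuel.Theses
open Summit.Schanuel.Schanuel.Theorems.AclSubsetLogFreeCore.Negative

namespace Summit.Schanuel.Schanuel.Theorems.RigidCore

namespace RealUndefinable

/-- A real number lies on the kernel line `ℚ·2πi` iff it is `0`. -/
theorem ofReal_mem_span_two_pi_I_iff {r : ℝ} :
    (r : ℂ) ∈ Submodule.span ℚ ({(2 * ↑Real.pi * Complex.I : ℂ)} : Set ℂ) ↔ r = 0 := by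
  constructor
  · intro h
    obtain ⟨q, hq⟩ := Submodule.mem_span_singleton.1 h
    rw [Rat.smul_def] at hq
    have hre := congrArg Complex.re hq
    simp at hre
    exact hre.symm
  · rintro rfl
    simp

/-- `e^{ln 2} = 2` is algebraic over `ℚ`. -/
theorem isAlgebraic_exp_log_two : IsAlgebraic ℚ (Complex.exp ((Real.log 2 : ℝ) : ℂ)) := by
  rw [← Complex.ofReal_exp, Real.exp_log two_pos, Complex.ofReal_ofNat]
  exact_mod_cast isAlgebraic_nat (R := ℚ) (A := ℂ) 2

/-- **Log-freeness of the core ⟹ `ln 2 ∉ C_EA`**: `e^{ln 2} = 2 ∈ ℚ̄` while the non-zero real `ln 2`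
is off the kernel line `ℚ·2πi`. -/
theorem log_two_not_mem_logFreeCore_of_logFree
    (hLF : ∀ u : ℂ, u ∈ logFreeCore → IsAlgebraic ℚ (Complex.exp u) →
        u ∈ Submodule.span ℚ ({(2 * ↑Real.pi * Complex.I : ℂ)} : Set ℂ)) :
    ((Real.log 2 : ℝ) : ℂ) ∉ logFreeCore := fun h =>
  Real.log_ne_zero_of_pos_of_ne_one two_pos (by norm_num)
    (ofReal_mem_span_two_pi_I_iff.1 (hLF _ h isAlgebraic_exp_log_two))

end RealUndefinable

/-- **C21 — log-freeness of the core + (A) ⟹ `ℝ ⊆ ℂ` is not `∅`-definable in `ℂ_exp`.**  If every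
`u ∈ C_EA` with `eᵘ ∈ ℚ̄` lies on `ℚ·2πi` (the conclusion of `(R) ⟹` "the log-free core is log-free")
and (A) `AclSubsetLogFreeCore` holds, then `Set.range ((↑) : ℝ → ℂ)` is not `∅`-definable in
`(ℂ, +, ·, exp)`: under (A) + `Def_∅(ℝ)` the landed `log_two_mem_logFreeCore_of_real_definable` gives
`ln 2 ∈ C_EA`, contradicting `RealUndefinable.log_two_not_mem_logFreeCore_of_logFree`.  Composed with
(R) this is the parameter-free case of Koiran's conjecture (open; KMO arXiv:1101.4224, p. 2). -/
theorem stub_realUndefinable_of_logFree :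
    (∀ u : ℂ, u ∈ logFreeCore → IsAlgebraic ℚ (Complex.exp u) →
        u ∈ Submodule.span ℚ ({(2 * ↑Real.pi * Complex.I : ℂ)} : Set ℂ)) →
      RigidCore.AclSubsetLogFreeCore →
        ¬ Set.Definable₁ (∅ : Set ℂ) Literature.ModelTheory.ExponentialFields.Language.expRing
            (Set.range ((↑) : ℝ → ℂ)) := by
  intro hLF hA hdef
  exact RealUndefinable.log_two_not_mem_logFreeCore_of_logFree hLF
    (log_two_mem_logFreeCore_of_real_definable hA hdef)

end Summit.Schanuel.Schanuel.Theorems.RigidCore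

end
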